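import Literature.Probability.Percolation.CorrelationLengthDKTThm2
import Literature.Probability.Percolation.CorrelationLengthDKTSlabDensity
import HarnessLib

/-!
# DKT 2020, Theorem 2 (supercritical), step 4: Theorem 7 and the §6 threshold bound in SLAB form

Topic `Literature/Probability/Percolation`. Proof file towards the supercritical half of

* H. Duminil-Copin, G. Kozma, V. Tassion, *Upper bounds on the percolation correlation length*,
  Progr. Probab. 77 (2020) = arXiv:1902.03207 [DuminilcopinKozmaTassion2020], Theorem 7 (§5):
  "Then `ℙ_{p+Cε}[0 ↔_{Slab_{2N}} ∞] ≥ ε/2`", and §6: "at `p_n + C/√(log n)` we already have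
  percolation in a slab".

The tree's `DKT20.thm7_criticalProb_le` and `DKT20.threshold_bound_of_prop1_prop5_Icc`
(`QuantitativeGMTheorem.lean`, `CorrelationLengthDKTAssembly.lean`) kept of Theorem 7 only the
consequence `p_c(ℤ^d) ≤ p + Cε` used for `p < p_c`. The supercritical case needs the slab
itself: the Martineau–Tassion run of the renormalisation percolates INSIDE the slab
`Slab_{2N} = {|x_j| ≤ 2N, j ≠ 1, 2}` (`GMStep.GMParams.theta_slab_pos`), so the very same proofs
give `p_c(Slab_{2N}) ≤ p + Cε`. This file re-runs them with that conclusion: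

* `criticalProb_slab_le_sprinkleParam_of_sphereFC` — the run: `p_c(Slab_{2N}, 0) ≤ sprinkleParam`;
* `thm7_slab` — Theorem 7 with conclusion `p_c(Slab_{2N}, 0) ≤ p + 1000 κ Λ p_lo^{-1} ε`
  (`dktSlab d N`, `CorrelationLengthDKTSlabDensity.lean`);
* `slab_threshold_bound_of_prop1_prop5_Icc`, `slab_threshold_bound` — the §6 assembly: there are
  `C₀, n₀` with `p_c(Slab_{2n}, 0) ≤ p + C₀/√(log n)` for all `n ≥ n₀` and all `0 < p ≤ 127/128`
  with `φ_p ≥ 1/e` on the origin sets of `Λ_n` (Propositions 1 and 5 supplied by `AKN.dkt_prop1`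
  and `DKT20.prop5`). The hypothesis `p < p_c` of the subcritical version only served to bound the
  densities by `127/128`; here it is replaced by `p ≤ 127/128` (and `p_hi = 255/256`), so that the
  bound applies at slightly supercritical `p` as in DKT's §6, case `p > p_c`.

## References

* H. Duminil-Copin, G. Kozma, V. Tassion, arXiv:1902.03207, §5 (Theorem 7, Lemmas 8–10), §6.
* S. Martineau, V. Tassion, Ann. Probab. 45 (2017), §4 [MartineauTassion2017].
-/

noncomputable section

namespace Literature.Probability.Percolation

namespace DKT20

open MeasureTheory Filter LatticeModels DCT16 GM GMStep
open scoped Topology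

variable {d : ℕ}

/-! ## The run percolates inside the slab -/

/-- `p_c` of induced subgraphs on equal vertex sets agree. [folklore] -/
theorem criticalProb_induce_congr {V : Type*} (G : SimpleGraph V) {S S' : Set V} (h : S = S') {x : V} {hx : x ∈ S} :
    criticalProb (G.induce S) ⟨x, hx⟩ = criticalProb (G.induce S') ⟨x, h ▸ hx⟩ := by
  subst h; rfl

/-- **`p_c(slab, 0) ≤ sprinkleParam p 100 r` from the sphere-meeting finite-size hypothesis** —
the slab form of `GMStep.GMParams.criticalProb_le_sprinkleParam_of_sphereFC` (same proof: the
lawful scheme percolates inside the slab with positive probability at the sprinkled density,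
`GMStep.GMParams.theta_slab_pos`). [cite: DuminilcopinKozmaTassion2020, Theorem 7 ("ℙ_{p+Cε}[0 ↔_{Slab_{2N}} ∞] > 0")] -/
theorem criticalProb_slab_le_sprinkleParam_of_sphereFC (P : GMParams) {η : ℝ} (hη : 0 ≤ η)
    (hFC : ∀ S : Finset (Site P.d), S ⊆ box P.d P.k →
      (∀ ρ, ρ ≤ P.k → ∃ v ∈ S, P.supDist 0 v = ρ) →
      ∀ (a : Fin P.d) (τ : Fin P.d → ℤˣ),
        1 - η < (bondPercolation (zdGraph P.d) P.p).real (linkEvent S (orthantFace a τ P.n) P.n))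
    (hp0 : 0 < (P.p : ℝ)) (hp1 : (P.p : ℝ) < 1) (t : ℕ)
    (hε : η / (1 - (P.p : ℝ)) ^ t + (1 - (P.p : ℝ) ^ (P.r + 1)) ^ t ≤ 1 / 64) :
    criticalProb ((zdGraph P.d).induce P.slab) ⟨0, P.zero_mem_slab⟩ ≤ sprinkleParam P.p GMParams.L P.r := by
  have hL := P.lawful_scheme_of_sphereFC hη hFC hp1 t
  have hθslab := P.theta_slab_pos hL hε hp0
  refine csInf_le ⟨0, ?_⟩ (Or.inl ⟨(sprinkleParam P.p GMParams.L P.r).2, hθslab⟩)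
  rintro x (⟨hx, -⟩ | hx)
  · exact hx.1
  · rw [Set.mem_singleton_iff] at hx; rw [hx]; exact zero_le_one

/-! ## Theorem 7 in slab form -/

/-- **DKT 2020, Theorem 7, in the SLAB form "`p_c(Slab_{2N}, 0) ≤ p + Cε`".** Same hypotheses,
constants and proof as `thm7_criticalProb_le` (Lemma 8 fed into the Martineau–Tassion run with the
sprinkling of Lemma 10), the conclusion being read off `criticalProb_slab_le_sprinkleParam_of_sphereFC`
on DKT's slab `Slab_{2N} = {|x_j| ≤ 2N, j ≠ 1, 2}` (`dktSlab d N = GMStep.GMParams.slab`).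
[cite: DuminilcopinKozmaTassion2020, Theorem 7 and §6] -/
theorem thm7_slab (hd : 3 ≤ d) (p : unitInterval) {p_lo p_hi : ℝ} (hlo : 0 < p_lo)
    (hlop : p_lo ≤ p) (hphi : (p : ℝ) ≤ p_hi) (hhi : p_hi < 1) {ε : ℝ} (hε0 : 0 < ε) (hε1 : ε ≤ 1)
    (hsmallT : 10 * (-Real.log (1 - p_hi)) * Fintype.card (HOct d) / p_lo * ε < 1)
    (hsmall : (3 * Real.exp (-(1 / ε)) + (2 * (1 / ε) ^ 2 + 2) *
        Real.exp (-((1 / ε) / Fintype.card (HOct d)))) * Real.exp ((1 / ε) / (2 * Fintype.card (HOct d))) ≤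
        (1 - p_hi) / 128)
    {k K n N : ℕ} (hkK : k ≤ K) (hK1 : 1 ≤ K) (hKn : 10 * (K : ℝ) ≤ ε ^ 2 * n) (hnN : n < N)
    (ha : ε ≤ (bondPercolation (zdGraph d) p).real (siteToBoundary d N))
    (hb : 1 - Real.exp (-(1 / ε)) ≤ (bondPercolation (zdGraph d) p).real
      (linkEvent (box d k) (innerBoundary (zdGraph d) (box d N)) N))
    (hc1 : (bondPercolation (zdGraph d) p).real (uniqZone (d := d) k K)ᶜ ≤ Real.exp (-(1 / ε)))
    (hc2 : (bondPercolation (zdGraph d) p).real (uniqZone (d := d) n N)ᶜ ≤ Real.exp (-(1 / ε))) :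
    criticalProb ((zdGraph d).induce (dktSlab d N)) ⟨0, zero_mem_dktSlab d N⟩ ≤
      p + 1000 * (-Real.log (1 - p_hi)) * Fintype.card (HOct d) / p_lo * ε := by
  haveI : NeZero d := ⟨by omega⟩
  have hκ1 : (1 : ℝ) ≤ Fintype.card (HOct d) := by exact_mod_cast Fintype.card_pos (α := HOct d)
  have hκ0 : (0 : ℝ) < Fintype.card (HOct d) := by linarith
  have hp0 : 0 < (p : ℝ) := hlo.trans_le hlop
  have hp1 : (p : ℝ) < 1 := hphi.trans_lt hhi
  have h1phi : 0 < 1 - p_hi := by linarith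
  have hΛ0 : 0 < -Real.log (1 - p_hi) := by
    rw [neg_pos]; exact Real.log_neg h1phi (by linarith)
  -- the scales and Lemma 8
  have hscale := scales_fit hε0 hε1 hK1 hKn
  have hKn' : K ≤ n := by
    have hKreal : (0 : ℝ) ≤ K := Nat.cast_nonneg K
    have hn0 : (0 : ℝ) ≤ n := Nat.cast_nonneg n
    have hε21 : ε ^ 2 ≤ 1 := by nlinarith
    have h1 : ε ^ 2 * (n : ℝ) ≤ 1 * n := mul_le_mul_of_nonneg_right hε21 hn0
    have : (K : ℝ) ≤ n := by linarith
    exact_mod_cast this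
  have hmargin := margin_le hε0 hε1 hκ1
  set η : ℝ := (1 - (ε - Real.exp (-(1 / ε)))) ^ ⌈2 / ε ^ 2⌉₊ +
      (⌈2 / ε ^ 2⌉₊ + 1) * Real.exp (-(1 / ε)) ^ ((Fintype.card (HOct d) : ℝ))⁻¹ + Real.exp (-(1 / ε)) +
      Real.exp (-(1 / ε)) with hηdef
  have hq0 : 0 < Real.exp (-(1 / ε)) := Real.exp_pos _
  have hqε : Real.exp (-(1 / ε)) ≤ ε / 2 := exp_neg_inv_le_half hε0
  have hη0 : 0 ≤ η := by
    have h1 : 0 ≤ (1 - (ε - Real.exp (-(1 / ε)))) ^ ⌈2 / ε ^ 2⌉₊ := pow_nonneg (by linarith) _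
    have h2 : 0 ≤ ((⌈2 / ε ^ 2⌉₊ : ℝ) + 1) * Real.exp (-(1 / ε)) ^ ((Fintype.card (HOct d) : ℝ))⁻¹ := by
      positivity
    rw [hηdef]; linarith
  -- the sprinkling window and `t`
  set T : ℝ := 10 * (-Real.log (1 - p_hi)) * Fintype.card (HOct d) / p_lo * ε with hT
  have hT0 : 0 < T := by positivity
  obtain ⟨m, hm1, hmT, hmlo⟩ := exists_pow_mem_window hlo hlop hp1 hT0 hsmallT
  have hx0 : 0 < (p : ℝ) ^ m := pow_pos hp0 m
  have hx1 : (p : ℝ) ^ m ≤ 1 := pow_le_one₀ hp0.le hp1.le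
  have hxlo : 10 * (-Real.log (1 - p_hi)) * Fintype.card (HOct d) * ε ≤ (p : ℝ) ^ m := by
    have : p_lo * T = 10 * (-Real.log (1 - p_hi)) * Fintype.card (HOct d) * ε := by
      rw [hT]; field_simp
    linarith
  obtain ⟨r, hr⟩ : ∃ r : ℕ, m = r + 1 := Nat.exists_eq_succ_of_ne_zero (by omega)
  have htge : 5 / (p : ℝ) ^ m ≤ (⌈5 / (p : ℝ) ^ m⌉₊ : ℕ) := Nat.le_ceil _
  have htle : ((⌈5 / (p : ℝ) ^ m⌉₊ : ℕ) : ℝ) < 5 / (p : ℝ) ^ m + 1 := Nat.ceil_lt_add_one (by positivity)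
  have hfail := failure_le (t := ⌈5 / (p : ℝ) ^ m⌉₊) hphi (hp0.trans_le hphi) hhi hκ0 hε0 hη0 hmargin hsmall
    hx0 hx1 hxlo htge htle
  rw [hr] at hfail
  -- the run
  let P : GMParams := ⟨d, hd, p, n, N, hnN, r⟩
  have hFC : ∀ S : Finset (Site P.d), S ⊆ box P.d P.k →
      (∀ ρ, ρ ≤ P.k → ∃ v ∈ S, P.supDist 0 v = ρ) →
      ∀ (a : Fin P.d) (τ : Fin P.d → ℤˣ),
        1 - η < (bondPercolation (zdGraph P.d) P.p).real (linkEvent S (orthantFace a τ P.n) P.n) := by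
    intro S hS hmeet a τ
    have hmeet' : ∀ ρ, ρ ≤ n → ∃ v ∈ S, v ∈ innerBoundary (zdGraph d) (box d ρ) := by
      intro ρ hρ
      obtain ⟨v, hv, hvρ⟩ := hmeet ρ hρ
      exact ⟨v, hv, mem_innerBoundary_of_supDist_eq P hvρ⟩
    have h := lemma8 p hkK hK1 hKn' hnN.le hscale ha hb hc1 hc2 hS hmeet' a τ
    have hlt : 1 - η < 1 - ((1 - (ε - Real.exp (-(1 / ε)))) ^ ⌈2 / ε ^ 2⌉₊ +
        (⌈2 / ε ^ 2⌉₊ + 1) * Real.exp (-(1 / ε)) ^ ((Fintype.card (HOct d) : ℝ))⁻¹ + Real.exp (-(1 / ε))) := by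
      rw [hηdef]; linarith
    exact hlt.trans_le h
  have hrun := criticalProb_slab_le_sprinkleParam_of_sphereFC P hη0 hFC hp0 hp1 _ hfail
  have hslab : P.slab = dktSlab d N := by
    ext x
    simp only [GMParams.slab, GMParams.ax0, GMParams.ax1, dktSlab, Set.mem_setOf_eq, ne_eq, Fin.ext_iff]
    rfl
  rw [criticalProb_induce_congr (zdGraph d) hslab] at hrun
  -- the sprinkled density
  have hsp := sprinkleParam_le p GMParams.L r
  have hL : (GMParams.L : ℝ) = 100 := by norm_num [GMParams.L]
  have hxT : (p : ℝ) ^ (r + 1) < T := by rw [← hr]; exact hmT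
  calc criticalProb ((zdGraph d).induce (dktSlab d N)) ⟨0, zero_mem_dktSlab d N⟩ ≤ sprinkleParam p GMParams.L r := hrun
    _ ≤ p + GMParams.L * (p : ℝ) ^ (r + 1) := hsp
    _ = p + 100 * (p : ℝ) ^ (r + 1) := by rw [hL]
    _ ≤ p + 100 * T := by linarith
    _ = p + 1000 * (-Real.log (1 - p_hi)) * Fintype.card (HOct d) / p_lo * ε := by
        rw [hT]; ring

/-! ## The §6 threshold bound in slab form -/

/-- **DKT 2020, §6: `p_c(Slab_{2n}, 0) ≤ p + C₀/√(log n)` from Propositions 1 and 5 on compact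
parameter ranges.** Same statement and proof as `threshold_bound_of_prop1_prop5_Icc`, with the
slab conclusion of `thm7_slab` and the hypothesis `p ≤ 127/128` in place of `p < p_c` (the machine
runs at densities `≤ 127/128 + 1/256 = 255/256 = p_hi`, `δ = min(1/(2de), 1/256)`).
[cite: DuminilcopinKozmaTassion2020, §6 (proof of Theorems 2 and 3)] -/
theorem slab_threshold_bound_of_prop1_prop5_Icc (hd : 3 ≤ d)
    (h1 : ∀ δ : ℝ, 0 < δ → ∃ α : ℝ, 0 < α ∧ α < 1 ∧ ∃ n₁ : ℕ, ∀ n : ℕ, n₁ ≤ n → ∀ p : unitInterval,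
      δ ≤ (p : ℝ) → (p : ℝ) ≤ 1 - δ →
      (bondPercolation (zdGraph d) p).real (uniqZone (d := d) ⌊(n : ℝ) ^ α⌋₊ n)ᶜ ≤ (n : ℝ) ^ (-α))
    (h5 : ∀ δ : ℝ, 0 < δ → ∀ β : ℝ, 0 < β → β < 1 → ∃ C : ℝ, 0 < C ∧ ∃ n₅ : ℕ, ∀ n : ℕ, n₅ ≤ n →
      ∀ p q : unitInterval, δ ≤ (p : ℝ) → (q : ℝ) ≤ 1 - δ →
        (∀ S ∈ DCT16.originSets d n, Real.exp (-1) ≤ DCT16.phi p S) →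
        (p : ℝ) + C / Real.sqrt (Real.log n) ≤ q →
        1 - Real.exp (-Real.sqrt (Real.log n)) ≤
          (bondPercolation (zdGraph d) q).real
            (linkEvent (box d ⌊(n : ℝ) ^ β⌋₊) (innerBoundary (zdGraph d) (box d n)) n)) :
    ∃ C₀ : ℝ, 0 < C₀ ∧ ∃ n₀ : ℕ, ∀ n : ℕ, n₀ ≤ n → ∀ p : unitInterval, 0 < (p : ℝ) →
      (p : ℝ) ≤ 127 / 128 →
      (∀ S ∈ DCT16.originSets d n, Real.exp (-1) ≤ DCT16.phi p S) →
      criticalProb ((zdGraph d).induce (dktSlab d n)) ⟨0, zero_mem_dktSlab d n⟩ ≤ p + C₀ / Real.sqrt (Real.log n) := by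
  haveI : NeZero d := ⟨by omega⟩
  -- constants
  set κ : ℝ := (Fintype.card (HOct d) : ℝ) with hκ
  have hκ1 : 1 ≤ κ := by rw [hκ]; exact_mod_cast Fintype.card_pos (α := HOct d)
  have hκ0 : 0 < κ := by linarith
  set p_lo : ℝ := Real.exp (-1) / (2 * d) with hplo_def
  have hd0 : (0 : ℝ) < d := by exact_mod_cast (show 0 < d by omega)
  have hplo : 0 < p_lo := by rw [hplo_def]; positivity
  set δ : ℝ := min p_lo (1 / 256) with hδ
  have hδ0 : 0 < δ := lt_min hplo (by norm_num)
  have hδlo : δ ≤ p_lo := min_le_left _ _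
  have hδhi : (255 : ℝ) / 256 ≤ 1 - δ := by have := min_le_right p_lo (1 / 256 : ℝ); linarith
  obtain ⟨α, hα0, hα1, n₁, hP1⟩ := h1 δ hδ0
  have hβ0 : 0 < α ^ 3 / 2 := by positivity
  have hβ1 : α ^ 3 / 2 < 1 := by
    have : α ^ 3 < 1 := pow_lt_one₀ hα0.le hα1 (by norm_num)
    linarith
  obtain ⟨C₅, hC₅, n₅, hP5⟩ := h5 δ hδ0 (α ^ 3 / 2) hβ0 hβ1
  set Λ : ℝ := -Real.log (1 - 255 / 256) with hΛ
  have hΛ0 : 0 < Λ := by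
    rw [hΛ, neg_pos]; exact Real.log_neg (by norm_num) (by norm_num)
  set C₇ : ℝ := 1000 * Λ * κ / p_lo with hC₇
  have hC₇0 : 0 < C₇ := by rw [hC₇]; positivity
  set A : ℝ := 10 * Λ * κ / p_lo + 256 * (C₅ + 1) + 4 with hA
  obtain ⟨y₀, hy₀⟩ := eventually_smallness hκ1 (c := (1 - 255 / 256) / 128) (by norm_num)
  -- the eventual side conditions
  have hev : ∀ᶠ N : ℕ in atTop, max n₁ 1 ≤ ⌊(N : ℝ) ^ (α ^ 2)⌋₊ ∧ max (max n₁ n₅) 2 ≤ N ∧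
      max y₀ A ≤ Real.sqrt (Real.log N) ∧
      10 * (⌊(N : ℝ) ^ (α ^ 2)⌋₊ : ℝ) * Real.log N ≤ ⌊(N : ℝ) ^ α⌋₊ ∧ ⌊(N : ℝ) ^ α⌋₊ < N ∧
      (⌊(N : ℝ) ^ (α ^ 3 / 2)⌋₊ ≤ ⌊(⌊(N : ℝ) ^ (α ^ 2)⌋₊ : ℝ) ^ α⌋₊ ∧
        (⌊(N : ℝ) ^ (α ^ 2)⌋₊ : ℝ) ^ (-α) ≤ Real.exp (-Real.sqrt (Real.log N))) ∧
      ((N : ℝ)) ^ (-α) ≤ Real.exp (-Real.sqrt (Real.log N)) :=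
    (eventually_le_floor_rpow (by positivity) _).and ((eventually_ge_atTop _).and
      ((tendsto_sqrt_log_natCast.eventually_ge_atTop _).and ((eventually_scales hα0 hα1).and
        ((eventually_floor_rpow_lt hα1).and ((eventually_inner_scales hα0 hα1).and
          (eventually_rpow_neg_le_exp hα0))))))
  obtain ⟨n₀, hn₀⟩ := Filter.eventually_atTop.1 hev
  refine ⟨C₅ + 1 + C₇, by positivity, n₀, fun N hN p hp0 hp78 hφ => ?_⟩
  obtain ⟨heK, heN, hes, hesc, henN, ⟨hek, heKα⟩, heNα⟩ := hn₀ N hN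
  -- the scales and `s = √(log N)`, `ε = 1/s`
  set K : ℕ := ⌊(N : ℝ) ^ (α ^ 2)⌋₊ with hKdef
  set nD : ℕ := ⌊(N : ℝ) ^ α⌋₊ with hnDdef
  set k : ℕ := ⌊(K : ℝ) ^ α⌋₊ with hkdef
  set s : ℝ := Real.sqrt (Real.log N) with hsdef
  have hN2 : 2 ≤ N := le_of_max_le_right heN
  have hNn₁ : n₁ ≤ N := le_of_max_le_left (le_of_max_le_left heN)
  have hNn₅ : n₅ ≤ N := le_of_max_le_right (le_of_max_le_left heN)
  have hNreal : (2 : ℝ) ≤ N := by exact_mod_cast hN2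
  have hlogN : 0 < Real.log N := Real.log_pos (by linarith)
  have hs0 : 0 < s := Real.sqrt_pos.2 hlogN
  have hss : s ^ 2 = Real.log N := Real.sq_sqrt hlogN.le
  have hsA : A ≤ s := le_of_max_le_right hes
  have hsy : y₀ ≤ s := le_of_max_le_left hes
  set ε : ℝ := 1 / s with hεdef
  have hε0 : 0 < ε := by positivity
  have hεs : 1 / ε = s := by rw [hεdef, one_div_one_div]
  -- trivial case
  by_cases htriv : 1 ≤ (p : ℝ) + (C₅ + 1 + C₇) / s
  · exact (criticalProb_mem_Icc _ _).2.trans htriv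
  push Not at htriv
  -- consequences of `s ≥ A`
  have hA1 : 10 * Λ * κ / p_lo < s := by
    have : 0 < 256 * (C₅ + 1) + 4 := by positivity
    linarith
  have hA2 : 256 * (C₅ + 1) ≤ s := by
    have : 0 ≤ 10 * Λ * κ / p_lo := by positivity
    linarith
  have hA3 : 4 ≤ s := by
    have : 0 ≤ 10 * Λ * κ / p_lo := by positivity
    have : 0 ≤ 256 * (C₅ + 1) := by positivity
    linarith
  have hε4 : ε ≤ 1 / 4 := by rw [hεdef]; exact one_div_le_one_div_of_le (by norm_num) hA3
  have hε1 : ε ≤ 1 := by linarith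
  have hC5ε : (C₅ + 1) * ε ≤ 1 / 256 := by
    rw [hεdef, mul_one_div, div_le_iff₀ hs0]; linarith
  have hsmallT : 10 * Λ * κ / p_lo * ε < 1 := by
    rw [hεdef, mul_one_div, div_lt_one hs0]; exact hA1
  -- the parameter `p_T = p + (C₅ + 1) ε`
  have hsplit : (C₅ + 1 + C₇) / s = (C₅ + 1) * ε + C₇ * ε := by rw [hεdef]; field_simp
  have hpT1 : (p : ℝ) + (C₅ + 1) * ε < 1 := by
    have : 0 ≤ C₇ * ε := by positivity
    linarith
  set pT : unitInterval := ⟨(p : ℝ) + (C₅ + 1) * ε, by have := p.2.1; positivity, hpT1.le⟩ with hpTdef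
  have hplop : p_lo ≤ p := pLo_le (by omega) p hφ
  have hpT_lo : p_lo ≤ pT := by
    show p_lo ≤ (p : ℝ) + (C₅ + 1) * ε
    have : 0 ≤ (C₅ + 1) * ε := by positivity
    linarith
  have hpT_hi : (pT : ℝ) ≤ 255 / 256 := by
    show (p : ℝ) + (C₅ + 1) * ε ≤ 255 / 256
    linarith
  -- the scales
  have hK1 : 1 ≤ K := le_of_max_le_right heK
  have hKn₁ : n₁ ≤ K := le_of_max_le_left heK
  have hKreal1 : (1 : ℝ) ≤ K := by exact_mod_cast hK1
  have hkK : k ≤ K := by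
    have h1 : (k : ℝ) ≤ (K : ℝ) ^ α := Nat.floor_le (by positivity)
    have h2 : (K : ℝ) ^ α ≤ K := by
      calc (K : ℝ) ^ α ≤ (K : ℝ) ^ (1 : ℝ) := Real.rpow_le_rpow_of_exponent_le hKreal1 hα1.le
        _ = K := Real.rpow_one _
    exact_mod_cast h1.trans h2
  have hKn : 10 * (K : ℝ) ≤ ε ^ 2 * nD := by
    have hε2 : ε ^ 2 = 1 / Real.log N := by rw [hεdef, one_div_pow, hss]
    rw [hε2, one_div_mul_eq_div, le_div_iff₀ hlogN]
    linarith [hesc]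
  have hnN : nD < N := henN
  -- (a) by Proposition 4 at `q = p + ε ≤ p_T`
  have hpε1 : (p : ℝ) + ε < 1 := by
    have : 0 ≤ C₅ * ε := by positivity
    linarith
  have ha : ε ≤ (bondPercolation (zdGraph d) pT).real (siteToBoundary d N) := by
    have h4 := prop4' (d := d) (L := N) (by omega) p hp0 (q := (p : ℝ) + ε) (by linarith) hpε1 hφ
    have hmin : min ((p : ℝ) + ε - p) (1 - Real.exp 1 / 4) = ε := by
      rw [add_sub_cancel_left]
      refine min_eq_left ?_
      have := Real.exp_one_lt_d9
      linarith
    rw [hmin] at h4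
    refine h4.trans (real_mono_of_isUpperSet (zdGraph d) (isUpperSet_siteToBoundary d N)
      (measurableSet_siteToBoundary d N) ?_)
    change (p : ℝ) + ε ≤ (p : ℝ) + (C₅ + 1) * ε
    have : 0 ≤ C₅ * ε := by positivity
    linarith
  -- (b) by Proposition 5 at `q = p_T`, and `Λ_{⌊N^β⌋} ⊆ Λ_k`
  have hb : 1 - Real.exp (-(1 / ε)) ≤ (bondPercolation (zdGraph d) pT).real
      (linkEvent (box d k) (innerBoundary (zdGraph d) (box d N)) N) := by
    have hq : (p : ℝ) + C₅ / Real.sqrt (Real.log N) ≤ pT := by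
      show (p : ℝ) + C₅ / s ≤ (p : ℝ) + (C₅ + 1) * ε
      rw [hεdef, mul_one_div]
      have : C₅ / s ≤ (C₅ + 1) / s := div_le_div_of_nonneg_right (by linarith) hs0.le
      linarith
    have h := hP5 N hNn₅ p pT (hδlo.trans hplop) (hpT_hi.trans hδhi) hφ hq
    rw [hεs]
    exact h.trans (measureReal_mono (linkEvent_mono_left (box_mono d hek) _ _))
  -- (c) by Proposition 1 at the scales `K` and `N`
  have hc1 : (bondPercolation (zdGraph d) pT).real (uniqZone (d := d) k K)ᶜ ≤ Real.exp (-(1 / ε)) := by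
    rw [hεs]; exact (hP1 K hKn₁ pT (hδlo.trans hpT_lo) (hpT_hi.trans hδhi)).trans heKα
  have hc2 : (bondPercolation (zdGraph d) pT).real (uniqZone (d := d) nD N)ᶜ ≤ Real.exp (-(1 / ε)) := by
    rw [hεs]; exact (hP1 N hNn₁ pT (hδlo.trans hpT_lo) (hpT_hi.trans hδhi)).trans heNα
  -- the smallness inequality at `y = 1/ε = s`
  have hsmall : (3 * Real.exp (-(1 / ε)) + (2 * (1 / ε) ^ 2 + 2) *
      Real.exp (-((1 / ε) / Fintype.card (HOct d)))) * Real.exp ((1 / ε) / (2 * Fintype.card (HOct d))) ≤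
        (1 - 255 / 256) / 128 := by
    rw [hεs]; exact hy₀ s hsy
  -- Theorem 7
  have h7 := thm7_slab hd pT (p_lo := p_lo) (p_hi := 255 / 256) hplo hpT_lo hpT_hi (by norm_num)
    hε0 hε1 hsmallT hsmall hkK hK1 hKn hnN ha hb hc1 hc2
  calc criticalProb ((zdGraph d).induce (dktSlab d N)) ⟨0, zero_mem_dktSlab d N⟩
      ≤ pT + 1000 * (-Real.log (1 - 255 / 256)) * Fintype.card (HOct d) / p_lo * ε := h7
    _ = (p : ℝ) + (C₅ + 1) * ε + C₇ * ε := by rw [hC₇, hΛ, hκ]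
    _ = p + (C₅ + 1 + C₇) / Real.sqrt (Real.log N) := by rw [← hsdef, hsplit]; ring

/-- **DKT 2020, §6, slab threshold bound (inputs discharged).** In dimension `d ≥ 3` there are
`C₀ > 0` and `n₀` such that for all `n ≥ n₀` and all densities `0 < p ≤ 127/128` with
`φ_p(S) ≥ 1/e` for every `0 ∈ S ⊆ Λ_n`, the slab `Slab_{2n}` percolates strictly above
`p + C₀/√(log n)`: `p_c(Slab_{2n}, 0) ≤ p + C₀/√(log n)`. Propositions 1 and 5 are the tree's
`AKN.dkt_prop1` and `DKT20.prop5`. [cite: DuminilcopinKozmaTassion2020, Theorem 3 / Theorem 7 and §6] -/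
theorem slab_threshold_bound (hd : 3 ≤ d) :
    ∃ C₀ : ℝ, 0 < C₀ ∧ ∃ n₀ : ℕ, ∀ n : ℕ, n₀ ≤ n → ∀ p : unitInterval, 0 < (p : ℝ) →
      (p : ℝ) ≤ 127 / 128 →
      (∀ S ∈ DCT16.originSets d n, Real.exp (-1) ≤ DCT16.phi p S) →
      criticalProb ((zdGraph d).induce (dktSlab d n)) ⟨0, zero_mem_dktSlab d n⟩ ≤ p + C₀ / Real.sqrt (Real.log n) :=
  slab_threshold_bound_of_prop1_prop5_Icc hd (fun δ hδ => AKN.dkt_prop1 (d := d) (by omega) hδ) (prop5 d hd)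

end DKT20

end Literature.Probability.Percolation

end
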